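import Summits.QuantumFields.BalabanUV.Beta.D1BFx.DressedMixVertexSiteSplit
import Summits.QuantumFields.BalabanUV.Beta.D1BFx.ColumnGaugeNativeFirstOrder
import Summits.QuantumFields.BalabanUV.Beta.SymCorrectorMixedSiteNull

/-!
# `BalabanUV.Beta.D1BFx.DressedMixVertexSiteNull` — road «BF-x», binder row D1, slot (K) ∕ junction (J1), PART 24 HEAD (H3-Δ): **THE COLUMN HALF OF THE MIXED WORDS
# UNDER THE TADPOLE** (leaf-03 g32, TT23; the column twin of TT21 `SymCorrectorMixedSiteNull.tadpole_WMs_eq`).  TT22 `DressedMixVertexSiteSplit` §2 evaluates the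
# OWNER d1-p2 g24's letter-free column word `W^{Mcol}_c μ y ν y′ := (mixOfK G₀ N M₂ − mixOfK K₀ N M₂) μ y ν y′ + (ν y′ μ y)` (`ChartDefectLiteralColumnPin`,
# `ChartDefectTwoPinsLiteral`; `G₀ = coDressKBmAt ρ N K₀`) under the site-law mixed letter as `−ξ′ • (ANCHOR word − LEFT word)` at each bond order:
# ANCHOR `vertexOfM K N (ρ′ w′ ↦ χ_{μ,y}((N:ℤ)•w′ + ϱ) • Mt ρ′ w′) ν y′` (a multiplier vertex whose table is RESCALED by the column gauge function read at the
# multiplier roots), LEFT `diagK (χ_{μ,y}∘legSite ϱ) ∘ vertexOfM K N Mt ν y′`.  Against every spread sgn-symmetric propagator `G` and for a row-parity-odd coarse-localised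
# `Mt`: §1 the ANCHOR word is a parity-odd localised vertex, hence TADPOLE-NULL (`tadpole_eq_zero_of_parity`), and the LEFT word is HALF A COMMUTATOR under the tadpole
# (TT21 `tadpole_comp_diagK_left_eq`); so `tadpole G (ξ′ • (ANCHOR − LEFT)) = (ξ′∕2)·tadpole G (conjV (V_Mt ν y′) (diagK (χ∘legSite ϱ)))`.  §2 composes with TT22 at BOTH
# bond orders: the `abel` capstone `W^{Mcol} = −ξ′•(A − L)(μy, νy′) − ξ′•(A − L)(νy′, μy)` (OWNER W-g24-6 «welcome») and
# **`tadpole G (W^{Mcol} μ y ν y′) = −(ξ′∕2)·tadpole G (conjV (V_Mt ν y′) Λ′[χ_{μ,y}] + conjV (V_Mt μ y) Λ′[χ_{ν,y′}])`** — under the tadpole the column mixed word is a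
# COMMUTATOR word of locked column weights with the multiplier vertex, i.e. of the `Wmix(Λ; V)` grammar (leaf-01 g32 `ColumnGaugePairContact`); `tadpole_WMcol_eq_Wmix`
# writes it in exactly that bracket: `tadpole G (W^{Mcol} μ y ν y′) = (ξ′∕2)·tadpole G ([Λ′[χ_{ν,y′}], V_Mt μ y] + [Λ′[χ_{μ,y}], V_Mt ν y′])`, `[D, V] := D∘V − V∘D`.

HONEST DEPENDENCY (cell records, verbatim): «continuum YM on T⁴ ⇐ BetaPertH ∧ nine spine estimates (0/9 proved); BetaPertH ⇐ (D1) ∧ (D4) ∧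
CAP+tail; G-an2-4 gates asym, D1 and NE2/3/4.»  HONEST FRAMING (cell contract, verbatim): «discharging `BetaPertH` makes Bałaban's UV stability
UNCONDITIONAL — a real constructive-QFT result; it is NOT the continuum limit and NOT the Clay problem.»  THIS MODULE is [folklore] parity ∕ trace bookkeeping BY NAME
over TT21 (`tadpole_comp_diagK_left_eq`, `loc_vertexOfM_of_spr`), TT22 (`mixOfK_coDressKBmAt_eq_of_siteLetter`), leaf-01's `loc_diagK_weight_legSite` ∕ `abs_bmGaugeAt_weight_le`,
an2's `trK_vertexOfM_eq_neg_sgnK_of_rows`, leaf-05's `tadpole_eq_zero_of_parity`; the site-law letter `hMs` and the row parity `hMp` are HYPOTHESES; instance NOT claimed;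
it PRICES NOTHING (an identity under the tadpole, no bound); no definition, no `def … : Prop`, nothing cited, 0 sorry.  0∕4 row-D1 binders; (J1) ONE OPEN ROW; (K) NOT closed;
NOT D1, NEVER «G-an2-4 closed», NOT `BetaPertH`, NOT continuum, NOT Clay.

ABSOLUTE RULE (cell charter, verbatim): «No internally-minted statement may enter as a cited fact. Every hypothesis is either kernel-proved in
this package or a verbatim quotation of a PUBLISHED theorem with page reference. The manuscript(s) under audit are NOT citable for their own
disputed steps — they are the thing under adjudication; programme-internal (2001/route/tribunal) claims are never citable.»

Unit `b2b-balaban-beta-d1-formalise-leaf-03` (gen 32), 2026-08-23.  No existing file touched.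
-/

noncomputable section

namespace Summit.QuantumFields.BalabanUV.Beta.D1BFx.DressedMixVertexSiteNull

open Finset
open scoped BigOperators
open Literature.MathematicalPhysics.QuantumFieldTheory
open Literature.MathematicalPhysics.QuantumFieldTheory.LatticeForm (quo)
open Literature.MathematicalPhysics.QuantumFieldTheory.Balaban1983to89
open Literature.MathematicalPhysics.QuantumFieldTheory.Balaban1983to89.Beta
open B12Sec2to5 (l1 l1_nonneg)
open B4ContourShift (supNorm)
open ExpKernelCalculus (MKer Decays BiLoc VertexFamily comp tadpole)
open KernelReflection (tadpole_smul)
open KernelWard (divV)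
open OneStepResolventKernel (Fib)
open OneStepKernelFamily (colH)
open SecondOrderResponse (vertexOfM mixOfK LocStencilFM)
open AffineAveraging (Site box toSite)
open Summit.QuantumFields.BalabanUV.Beta.TameKernelCalculus (Spr Loc trK Loc.comp Loc.add tadpole_add)
open Summit.QuantumFields.BalabanUV.Beta.BorderedHessian (sgnK diagK)
open Summit.QuantumFields.BalabanUV.Beta.KernelWardRemainderParity (trK_vertexOfM_eq_neg_sgnK_of_rows)
open Summit.QuantumFields.BalabanUV.Beta.SpineRecursiveParity (parityOdd_smul)
open Summit.QuantumFields.BalabanUV.Beta.KernelWardRelativeEnd (tadpole_eq_zero_of_parity)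
open Summit.QuantumFields.BalabanUV.Beta.KernelWardRelative (tadpole_sub)
open Summit.QuantumFields.BalabanUV.Beta.ChartConjugation (conjV)
open Summit.QuantumFields.BalabanUV.Beta.AveragingWardRootedStencils (legSite legInd)
open Summit.QuantumFields.BalabanUV.Beta.AxialDressingRooted (coDressKBmAt)
open Summit.QuantumFields.BalabanUV.Beta.AxialProjectorBlockMean (bmGaugeAt)
open Summit.QuantumFields.BalabanUV.Beta.SymCorrectorMixedSiteNull (tadpole_comp_diagK_left_eq loc_vertexOfM_of_spr)
open Summit.QuantumFields.BalabanUV.Beta.D1BFx.ColumnGaugeNativeFirstOrder (loc_diagK_weight_legSite)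
open Summit.QuantumFields.BalabanUV.Beta.D1BFx.DressedVertexSplit (abs_bmGaugeAt_weight_le)
open Summit.QuantumFields.BalabanUV.Beta.D1BFx.DressedMixVertexSiteSplit (mixOfK_coDressKBmAt_eq_of_siteLetter)

variable {d : ℕ}

/-! ## §1 The column ANCHOR word is tadpole-null; the column LEFT word is half a commutator under the tadpole -/

section Column

variable {n : ℕ} (hn : 0 < n) {G : MKer (d + 1) (Fib d)} (hG : Spr G) (hGt : trK G = sgnK G) {K : MKer (d + 1) (Fib d)} (hK : Spr K)
  {M : Fin (d + 1) → Site (d + 1) → MKer (d + 1) (Fib d)} {CM δM : ℝ} (hMv : VertexFamily M n CM δM) (hδM : 0 < δM)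
  (hMp : ∀ ρ w, trK (M ρ w) = -sgnK (M ρ w)) {χ : Site (d + 1) → ℝ} {Cχ δχ : ℝ} {p : Site (d + 1)} (hCχ : 0 ≤ Cχ) (hδχ : 0 < δχ)
  (hχ : ∀ u, |χ u| ≤ Cχ * Real.exp (-δχ * l1 (u - p))) (ϱ : Site (d + 1))
include hn hG hGt hK hMv hδM hMp hCχ hδχ hχ

omit hn hG hGt hK hδM hMp in
/-- [folklore] **THE RESCALED TABLE IS A VERTEX FAMILY**: a coarse-localised multiplier table rescaled by a bounded weight read at the multiplier roots,
`ρ′ w′ ↦ χ((N:ℤ)•w′ + ϱ) • M ρ′ w′`, is `VertexFamily … n (Cχ·CM) δM` (a decaying weight is bounded by its constant). -/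
theorem vertexFamily_anchorTable : VertexFamily (fun ρ' w' => χ ((n : ℤ) • w' + ϱ) • M ρ' w') n (Cχ * CM) δM := by
  have hχb : ∀ w, |χ w| ≤ Cχ := fun w =>
    (hχ w).trans (mul_le_of_le_one_right hCχ (Real.exp_le_one_iff.2 (mul_nonpos_of_nonpos_of_nonneg (neg_nonpos.2 hδχ.le) (l1_nonneg _))))
  intro ρ w x z a b
  dsimp only
  rw [Pi.smul_apply, Pi.smul_apply, Pi.smul_apply, Pi.smul_apply, smul_eq_mul, abs_mul, mul_assoc]
  exact mul_le_mul (hχb _) (hMv ρ w x z a b) (abs_nonneg _) hCχ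

omit hG hGt hMp in
/-- [folklore] **THE COLUMN ANCHOR WORD IS LOCALISED**: `Loc (vertexOfM K n (ρ′ w′ ↦ χ((n:ℤ)•w′ + ϱ) • M ρ′ w′) ν y′)` (TT21 `loc_vertexOfM_of_spr` on the rescaled table). -/
theorem loc_colAnchor (ν : Fin (d + 1)) (y' : Site (d + 1)) : Loc (vertexOfM K n (fun ρ' w' => χ ((n : ℤ) • w' + ϱ) • M ρ' w') ν y') :=
  loc_vertexOfM_of_spr hn hK (vertexFamily_anchorTable hMv hCχ hδχ hχ ϱ) hδM ν y'

/-- [folklore] **THE COLUMN ANCHOR WORD IS TADPOLE-NULL** against every spread sgn-symmetric `G`: the rescaled table is row-parity-odd (`parityOdd_smul`), so its multiplier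
vertex is parity-odd (`trK_vertexOfM_eq_neg_sgnK_of_rows`) and localised — `tadpole_eq_zero_of_parity`. -/
theorem tadpole_colAnchor_eq_zero (ν : Fin (d + 1)) (y' : Site (d + 1)) :
    tadpole G (vertexOfM K n (fun ρ' w' => χ ((n : ℤ) • w' + ϱ) • M ρ' w') ν y') = 0 :=
  tadpole_eq_zero_of_parity hG hGt (loc_colAnchor hn hK hMv hδM hCχ hδχ hχ ϱ ν y')
    (trK_vertexOfM_eq_neg_sgnK_of_rows K (fun ρ w => parityOdd_smul _ (hMp ρ w)) ν y')

omit hn hG hGt hK hMv hδM hMp in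
/-- [folklore] **THE COLUMN GENERATOR AT UNIT SCALAR IS LOCALISED**: `Loc (diagK (χ∘legSite ϱ))` for a weight decaying from `p` (leaf-01's `loc_diagK_weight_legSite` at `ξ = 1`). -/
theorem loc_colGen : Loc (diagK fun z b => χ (legSite ϱ z b)) := by
  have h := loc_diagK_weight_legSite hCχ hδχ hχ ϱ 1
  simpa only [one_mul] using h

/-- [folklore] **THE COLUMN LEFT WORD IS HALF A COMMUTATOR UNDER THE TADPOLE**: `tadpole G (diagK (χ∘legSite ϱ) ∘ V_M ν y′) = −½·tadpole G (conjV (V_M ν y′) (diagK (χ∘legSite ϱ)))`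
for row-parity-odd `M` (TT21 `tadpole_comp_diagK_left_eq`). -/
theorem tadpole_colLeft_eq (ν : Fin (d + 1)) (y' : Site (d + 1)) :
    tadpole G (comp (diagK fun z b => χ (legSite ϱ z b)) (vertexOfM K n M ν y'))
      = -(1 / 2 : ℝ) * tadpole G (conjV (vertexOfM K n M ν y') (diagK fun z b => χ (legSite ϱ z b))) :=
  tadpole_comp_diagK_left_eq hG hGt (loc_colGen hCχ hδχ hχ ϱ) (loc_vertexOfM_of_spr hn hK hMv hδM ν y') (trK_vertexOfM_eq_neg_sgnK_of_rows K hMp ν y')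

/-- [folklore] **THE COLUMN MIXED WORD AT ONE BOND ORDER UNDER THE TADPOLE**: `tadpole G (ξ′ • (ANCHOR − LEFT)) = (ξ′∕2)·tadpole G (conjV (V_M ν y′) (diagK (χ∘legSite ϱ)))`. -/
theorem tadpole_colWord_eq (ξ' : ℝ) (ν : Fin (d + 1)) (y' : Site (d + 1)) :
    tadpole G (ξ' • (vertexOfM K n (fun ρ' w' => χ ((n : ℤ) • w' + ϱ) • M ρ' w') ν y' - comp (diagK fun z b => χ (legSite ϱ z b)) (vertexOfM K n M ν y')))
      = (ξ' / 2) * tadpole G (conjV (vertexOfM K n M ν y') (diagK fun z b => χ (legSite ϱ z b))) := by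
  rw [tadpole_smul, tadpole_sub hG (loc_colAnchor hn hK hMv hδM hCχ hδχ hχ ϱ ν y')
      ((loc_colGen hCχ hδχ hχ ϱ).comp (loc_vertexOfM_of_spr hn hK hMv hδM ν y')),
    tadpole_colAnchor_eq_zero hn hG hGt hK hMv hδM hMp hCχ hδχ hχ ϱ ν y', tadpole_colLeft_eq hn hG hGt hK hMv hδM hMp hCχ hδχ hχ ϱ ν y']
  ring

end Column

/-! ## §2 Both bond orders with TT22: the letter-free column word `W^{Mcol}` and its tadpole -/

section Pair

variable {N : ℕ} [NeZero N] (hN : 1 ≤ N) {r : Fin (d + 1) → ℕ} (hr : r ∈ box (d + 1) N) {K : MKer (d + 1) (Fib d)}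
  (hK : ∃ δ C : ℝ, 0 < δ ∧ 0 ≤ C ∧ Decays K C δ)
  {M₂ : Fin (d + 1) → Site (d + 1) → Fin (d + 1) → Site (d + 1) → MKer (d + 1) (Fib d)} {C₂ δ₂ : ℝ} (hM₂ : LocStencilFM N M₂ C₂ δ₂) (hδ₂ : 0 < δ₂)
  (μ : Fin (d + 1)) (y : Site (d + 1)) (ν : Fin (d + 1)) (y' : Site (d + 1)) {M c : ℝ} (hM : 0 ≤ M) (hc : 0 < c)
  (hKμ : ∀ κ u, |colH K N μ y κ u| ≤ M * Real.exp (-(c * supNorm (quo N u - y))))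
  (hKν : ∀ κ u, |colH K N ν y' κ u| ≤ M * Real.exp (-(c * supNorm (quo N u - y'))))
  {Mt : Fin (d + 1) → Site (d + 1) → MKer (d + 1) (Fib d)} {CM δM : ℝ} (hMv : VertexFamily Mt N CM δM) (hδM : 0 < δM) {ϱ : Site (d + 1)} {ξ' : ℝ}
  (hMs : ∀ ρ' w' w, divV (fun κ u => M₂ κ u ρ' w') w
    = ξ' • ((if w = (N : ℤ) • w' + ϱ then (1 : ℝ) else 0) • Mt ρ' w' - comp (diagK (legInd ϱ w)) (Mt ρ' w')))
include hN hr hK hM₂ hδ₂ hM hc hKμ hKν hMv hδM hMs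

/-- [folklore] **THE LETTER-FREE COLUMN WORD AT BOTH BOND ORDERS** (the OWNER d1-p2 g24's `W^{Mcol}_c`, `ChartDefectLiteralColumnPin`): with
`χ_{μ,y} := bmGaugeAt (toSite r) (colH K N μ y) N`, `A[χ] ν y′ := vertexOfM K N (ρ′ w′ ↦ χ((N:ℤ)•w′ + ϱ) • Mt ρ′ w′) ν y′`, `L[χ] ν y′ := diagK (χ∘legSite ϱ) ∘ vertexOfM K N Mt ν y′`:
`(mixOfK K′ N M₂ − mixOfK K N M₂) μ y ν y′ + (ν y′ μ y) = −(ξ′ • (A[χ_{μ,y}] ν y′ − L[χ_{μ,y}] ν y′)) − ξ′ • (A[χ_{ν,y′}] μ y − L[χ_{ν,y′}] μ y)` — TT22 §2 at both orders. -/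
theorem WMcol_eq_of_siteLetter :
    (mixOfK (coDressKBmAt (toSite r) N K) N M₂ μ y ν y' - mixOfK K N M₂ μ y ν y')
        + (mixOfK (coDressKBmAt (toSite r) N K) N M₂ ν y' μ y - mixOfK K N M₂ ν y' μ y)
      = -(ξ' • (vertexOfM K N (fun ρ' w' => bmGaugeAt (toSite r) (colH K N μ y) N ((N : ℤ) • w' + ϱ) • Mt ρ' w') ν y'
            - comp (diagK fun z b => bmGaugeAt (toSite r) (colH K N μ y) N (legSite ϱ z b)) (vertexOfM K N Mt ν y')))
        - ξ' • (vertexOfM K N (fun ρ' w' => bmGaugeAt (toSite r) (colH K N ν y') N ((N : ℤ) • w' + ϱ) • Mt ρ' w') μ y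
            - comp (diagK fun z b => bmGaugeAt (toSite r) (colH K N ν y') N (legSite ϱ z b)) (vertexOfM K N Mt μ y)) := by
  have hMtb : ∀ ρ w p q a e, |Mt ρ w p q a e| ≤ CM := fun ρ w p q a e =>
    (hMv ρ w p q a e).trans (mul_le_of_le_one_right ((hMv 0 0).nonneg (Sum.inl 0))
      (Real.exp_le_one_iff.2 (mul_nonpos_of_nonpos_of_nonneg (neg_nonpos.2 hδM.le) (add_nonneg (l1_nonneg _) (l1_nonneg _)))))
  rw [mixOfK_coDressKBmAt_eq_of_siteLetter hN hr hK hM₂ hδ₂ μ y ν y' hM hc hKμ hMtb hMs,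
    mixOfK_coDressKBmAt_eq_of_siteLetter hN hr hK hM₂ hδ₂ ν y' μ y hM hc hKν hMtb hMs]
  abel

/-- [folklore] **THE COLUMN MIXED WORD UNDER THE TADPOLE IS A COMMUTATOR WORD** (the column twin of TT21 `tadpole_WMs_eq`): against every spread sgn-symmetric `G` and for a
row-parity-odd `Mt`, `tadpole G (W^{Mcol} μ y ν y′) = −(ξ′∕2)·tadpole G (conjV (V_Mt ν y′) (diagK (χ_{μ,y}∘legSite ϱ)) + conjV (V_Mt μ y) (diagK (χ_{ν,y′}∘legSite ϱ)))` — the ANCHOR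
words drop (§1, parity), the LEFT words are half commutators (§1); the weights `χ_{μ,y} = bmGaugeAt (toSite r) (colH K N μ y) N` decay from `N•y` by leaf-01's `abs_bmGaugeAt_weight_le`. -/
theorem tadpole_WMcol_eq {G : MKer (d + 1) (Fib d)} (hG : Spr G) (hGt : trK G = sgnK G) (hMp : ∀ ρ w, trK (Mt ρ w) = -sgnK (Mt ρ w)) :
    tadpole G ((mixOfK (coDressKBmAt (toSite r) N K) N M₂ μ y ν y' - mixOfK K N M₂ μ y ν y')
        + (mixOfK (coDressKBmAt (toSite r) N K) N M₂ ν y' μ y - mixOfK K N M₂ ν y' μ y))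
      = -(ξ' / 2) * tadpole G (conjV (vertexOfM K N Mt ν y') (diagK fun z b => bmGaugeAt (toSite r) (colH K N μ y) N (legSite ϱ z b))
          + conjV (vertexOfM K N Mt μ y) (diagK fun z b => bmGaugeAt (toSite r) (colH K N ν y') N (legSite ϱ z b))) := by
  have hN0 : 0 < N := hN
  have hKs : Spr K := by
    obtain ⟨δ, C, hδ, -, hKd⟩ := hK
    exact ⟨C, δ, hδ, hKd⟩
  -- the two column weights decay from the coarse bond positions
  have hCχ : 0 ≤ (2 * (((d : ℝ) + 1) * N) * M) * Real.exp c := by positivity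
  have hδχ : 0 < c / (((d : ℝ) + 1) * N) := by positivity
  have hχμ := abs_bmGaugeAt_weight_le hN hr K μ y hM hc.le hKμ
  have hχν := abs_bmGaugeAt_weight_le hN hr K ν y' hM hc.le hKν
  -- localisations of the two one-order words and of the two commutators
  have locC : ∀ {V D : MKer (d + 1) (Fib d)}, Loc V → Loc D → Loc (conjV V D) := fun hV hD => (hV.comp hD).sub (hD.comp hV)
  have hVν := loc_vertexOfM_of_spr hN0 hKs hMv hδM ν y'
  have hVμ := loc_vertexOfM_of_spr hN0 hKs hMv hδM μ y
  have hDμ := loc_colGen hCχ hδχ hχμ ϱ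
  have hDν := loc_colGen hCχ hδχ hχν ϱ
  have L1 : Loc (ξ' • (vertexOfM K N (fun ρ' w' => bmGaugeAt (toSite r) (colH K N μ y) N ((N : ℤ) • w' + ϱ) • Mt ρ' w') ν y'
      - comp (diagK fun z b => bmGaugeAt (toSite r) (colH K N μ y) N (legSite ϱ z b)) (vertexOfM K N Mt ν y'))) :=
    ((loc_colAnchor hN0 hKs hMv hδM hCχ hδχ hχμ ϱ ν y').sub (hDμ.comp hVν)).smul _
  have L2 : Loc (ξ' • (vertexOfM K N (fun ρ' w' => bmGaugeAt (toSite r) (colH K N ν y') N ((N : ℤ) • w' + ϱ) • Mt ρ' w') μ y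
      - comp (diagK fun z b => bmGaugeAt (toSite r) (colH K N ν y') N (legSite ϱ z b)) (vertexOfM K N Mt μ y))) :=
    ((loc_colAnchor hN0 hKs hMv hδM hCχ hδχ hχν ϱ μ y).sub (hDν.comp hVμ)).smul _
  have key : ∀ {A B : MKer (d + 1) (Fib d)}, Loc A → Loc B → tadpole G (-A - B) = -tadpole G A - tadpole G B := by
    intro A B hA hB
    rw [tadpole_sub hG hA.neg hB, ← neg_one_smul ℝ A, tadpole_smul]
    ring
  rw [WMcol_eq_of_siteLetter hN hr hK hM₂ hδ₂ μ y ν y' hM hc hKμ hKν hMv hδM hMs, key L1 L2,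
    tadpole_colWord_eq hN0 hG hGt hKs hMv hδM hMp hCχ hδχ hχμ ϱ ξ' ν y', tadpole_colWord_eq hN0 hG hGt hKs hMv hδM hMp hCχ hδχ hχν ϱ ξ' μ y,
    tadpole_add hG (locC hVν hDμ) (locC hVμ hDν)]
  ring

/-- [folklore] **THE SAME, IN THE `Wmix(Λ; V)` BRACKET OF leaf-01 g32's `ColumnGaugePairContact.vertexFamily₂_Wmix_of_weight`** (`conjV` unfolded, the two commutators re-ordered
and their sign absorbed): `tadpole G (W^{Mcol} μ y ν y′) = (ξ′∕2)·tadpole G (([Λ′[χ_{ν,y′}], V_Mt μ y]) + ([Λ′[χ_{μ,y}], V_Mt ν y′]))` with `[D, V] := D∘V − V∘D`,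
`Λ′[χ] := diagK (χ∘legSite ϱ)` — so the HEAD prices `½•tadpole (W^{Mcol}_c)` with leaf-01's `Wmix` letter at `V := vertexOfM K N Mt`, `ξ := 1` (`one_mul`). -/
theorem tadpole_WMcol_eq_Wmix {G : MKer (d + 1) (Fib d)} (hG : Spr G) (hGt : trK G = sgnK G) (hMp : ∀ ρ w, trK (Mt ρ w) = -sgnK (Mt ρ w)) :
    tadpole G ((mixOfK (coDressKBmAt (toSite r) N K) N M₂ μ y ν y' - mixOfK K N M₂ μ y ν y')
        + (mixOfK (coDressKBmAt (toSite r) N K) N M₂ ν y' μ y - mixOfK K N M₂ ν y' μ y))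
      = (ξ' / 2) * tadpole G
          ((comp (diagK fun z b => bmGaugeAt (toSite r) (colH K N ν y') N (legSite ϱ z b)) (vertexOfM K N Mt μ y)
              - comp (vertexOfM K N Mt μ y) (diagK fun z b => bmGaugeAt (toSite r) (colH K N ν y') N (legSite ϱ z b)))
            + (comp (diagK fun z b => bmGaugeAt (toSite r) (colH K N μ y) N (legSite ϱ z b)) (vertexOfM K N Mt ν y')
              - comp (vertexOfM K N Mt ν y') (diagK fun z b => bmGaugeAt (toSite r) (colH K N μ y) N (legSite ϱ z b)))) := by
  rw [tadpole_WMcol_eq hN hr hK hM₂ hδ₂ μ y ν y' hM hc hKμ hKν hMv hδM hMs hG hGt hMp]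
  have e : conjV (vertexOfM K N Mt ν y') (diagK fun z b => bmGaugeAt (toSite r) (colH K N μ y) N (legSite ϱ z b))
        + conjV (vertexOfM K N Mt μ y) (diagK fun z b => bmGaugeAt (toSite r) (colH K N ν y') N (legSite ϱ z b))
      = (-1 : ℝ) • ((comp (diagK fun z b => bmGaugeAt (toSite r) (colH K N ν y') N (legSite ϱ z b)) (vertexOfM K N Mt μ y)
              - comp (vertexOfM K N Mt μ y) (diagK fun z b => bmGaugeAt (toSite r) (colH K N ν y') N (legSite ϱ z b)))
            + (comp (diagK fun z b => bmGaugeAt (toSite r) (colH K N μ y) N (legSite ϱ z b)) (vertexOfM K N Mt ν y')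
              - comp (vertexOfM K N Mt ν y') (diagK fun z b => bmGaugeAt (toSite r) (colH K N μ y) N (legSite ϱ z b)))) := by
    rw [neg_one_smul]
    unfold conjV
    abel
  rw [e, tadpole_smul]
  ring

end Pair

end Summit.QuantumFields.BalabanUV.Beta.D1BFx.DressedMixVertexSiteNull

end
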